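import Literature.NumberTheory.Sieve.DrappeauDispersionR1ppInner
import HarnessLib

/-!
# Drappeau 2017, §5.5: support and size of the coefficients `b_{𝐧,𝐫,𝐬}`

Topic `Literature/NumberTheory/Sieve`, part of the formalisation of §5 of S. Drappeau, Proc. London
Math. Soc. (3) 114 (2017) 684–732 = arXiv:1504.05549, p. 20–21: "for some sequence of
coefficients bounded by `τ(n₀𝐬)^A τ(𝐫)^A`", `‖b‖₂² ≪ 𝒜`.  For the explicit coefficients `bGen`
(of which `bCoef` and its conjugate are instances): the encoding
`(n₁,n₂,h) ↦ (𝐬,𝐫,𝐧) = (δ₂n₁, |a₂|n₀δ₁n₂, nVar)` is injective on the support, so `|b| ≤ sup|V|`,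
`b` is supported in the box `0 < 𝐧 ≤ nhi`, `R < 𝐫 ≤ 2R`, `S' < 𝐬 ≤ 2S'` (`R = |a₂|δ₁N`,
`S' = δ₂N/n₀`), and `∑ ‖b‖² ≤ (#B)²·(#h-range)·sup|V|²`.  Everything proved (no definition).

* `bCond_unique` — injectivity of the encoding on the support;
* `norm_bGen_le` — `‖b_{𝐧,𝐫,𝐬}‖ ≤ sup ‖V‖`;
* `bGen_support` — the support box;
* `sum3_indicator_le_one`, `sum_norm_bGen_sq_le` — the `ℓ²` bound.

## References

* S. Drappeau, Proc. London Math. Soc. (3) 114 (2017) 684–732, arXiv:1504.05549, §5.5 p. 20–21.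
  [cite: Drappeau2017, §5.5]
-/

noncomputable section

open Finset Real Complex
open scoped ArithmeticFunction.Moebius FourierTransform

namespace Literature.NumberTheory.Sieve

namespace Drappeau2017

section Coef

variable {a₁ a₂ : ℤ} {q₀ n₀ δ₁ δ₂ nlo nhi : ℕ} {σ : ℤ}

/-- `nVar` is `h` times a factor independent of `h`. [folklore] -/
theorem nVar_eq_mul (σ a₁ a₂ : ℤ) (q₀ : ℕ) (h : ℤ) (n₁ n₂ : ℕ) :
    nVar σ a₁ a₂ q₀ h n₁ n₂ = h * (σ * a₂.sign * a₁ * (((n₁ : ℤ) - n₂) / q₀)) := by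
  unfold nVar; ring

/-- **Injectivity of the encoding on the support**: two triples `(n₁,n₂,h)`, `(n₁',n₂',h')`
satisfying the conditions of `bGen` at the same `(𝐧,𝐫,𝐬)` coincide (`δ₂, |a₂|n₀δ₁ ≠ 0`,
`nlo ≥ 1`). [cite: Drappeau2017, §5.5 p. 20] -/
theorem bCond_unique (ha₂ : a₂ ≠ 0) (hn₀ : 0 < n₀) (hδ₁ : 0 < δ₁) (hδ₂ : 0 < δ₂) (hnlo : 1 ≤ nlo)
    {n r s : ℕ} {n₁ n₂ n₁' n₂' : ℕ} {h h' : ℤ}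
    (h1 : (δ₂ * n₁ = s ∧ a₂.natAbs * n₀ * δ₁ * n₂ = r ∧ nVar σ a₁ a₂ q₀ h n₁ n₂ = (n : ℤ) ∧
          (Nat.Coprime n₁ n₂ ∧ n₁ ≡ n₂ [MOD q₀] ∧ (n₀ * n₁).Coprime q₀ ∧ (n₀ * n₂).Coprime q₀ ∧
            ((nlo : ℕ) : ℤ) ≤ nVar σ a₁ a₂ q₀ h n₁ n₂ ∧ nVar σ a₁ a₂ q₀ h n₁ n₂ < ((nhi : ℕ) : ℤ)))) (h2 : (δ₂ * n₁' = s ∧ a₂.natAbs * n₀ * δ₁ * n₂' = r ∧ nVar σ a₁ a₂ q₀ h' n₁' n₂' = (n : ℤ) ∧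
          (Nat.Coprime n₁' n₂' ∧ n₁' ≡ n₂' [MOD q₀] ∧ (n₀ * n₁').Coprime q₀ ∧ (n₀ * n₂').Coprime q₀ ∧
            ((nlo : ℕ) : ℤ) ≤ nVar σ a₁ a₂ q₀ h' n₁' n₂' ∧ nVar σ a₁ a₂ q₀ h' n₁' n₂' < ((nhi : ℕ) : ℤ)))) : n₁ = n₁' ∧ n₂ = n₂' ∧ h = h' := by
  obtain ⟨hs1, hr1, hn1, -, -, -, -, hlo1, -⟩ := h1
  obtain ⟨hs2, hr2, hn2, -, -, -, -, -, -⟩ := h2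
  have e1 : n₁ = n₁' := Nat.eq_of_mul_eq_mul_left hδ₂ (hs1.trans hs2.symm)
  have hA : 0 < a₂.natAbs * n₀ * δ₁ := Nat.mul_pos (Nat.mul_pos (Int.natAbs_pos.2 ha₂) hn₀) hδ₁
  have e2 : n₂ = n₂' := Nat.eq_of_mul_eq_mul_left hA (hr1.trans hr2.symm)
  subst e1; subst e2
  refine ⟨rfl, rfl, ?_⟩
  have hne : nVar σ a₁ a₂ q₀ h n₁ n₂ ≠ 0 := by
    have : (1 : ℤ) ≤ nVar σ a₁ a₂ q₀ h n₁ n₂ := le_trans (by exact_mod_cast hnlo) hlo1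
    omega
  rw [nVar_eq_mul] at hn1 hn2 hne
  have hF : σ * a₂.sign * a₁ * (((n₁ : ℤ) - n₂) / q₀) ≠ 0 := fun h0 => hne (by rw [h0, mul_zero])
  exact mul_right_cancel₀ hF (hn1.trans hn2.symm)

/-- **`|b_{𝐧,𝐫,𝐬}| ≤ sup ‖V‖`.** [cite: Drappeau2017, §5.5 p. 20] -/
theorem norm_bGen_le (ha₂ : a₂ ≠ 0) (hn₀ : 0 < n₀) (hδ₁ : 0 < δ₁) (hδ₂ : 0 < δ₂) (hnlo : 1 ≤ nlo)
    (B : Finset ℕ) (H : ℕ) (V : ℤ → ℕ → ℕ → ℂ) {Vmax : ℝ} (hV0 : 0 ≤ Vmax)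
    (hV : ∀ h n₁ n₂, ‖V h n₁ n₂‖ ≤ Vmax) (n r s : ℕ) :
    ‖bGen a₁ a₂ B q₀ n₀ H σ nlo nhi δ₁ δ₂ V n r s‖ ≤ Vmax := by
  -- the sum over the product set, filtered by the support condition
  have hprod : bGen a₁ a₂ B q₀ n₀ H σ nlo nhi δ₁ δ₂ V n r s =
      ∑ y ∈ ((B ×ˢ B) ×ˢ (Finset.Icc (-(H : ℤ)) H).filter (fun h : ℤ => h ≠ 0)).filter (fun y : (ℕ × ℕ) × ℤ => (δ₂ * y.1.1 = s ∧ a₂.natAbs * n₀ * δ₁ * y.1.2 = r ∧ nVar σ a₁ a₂ q₀ y.2 y.1.1 y.1.2 = (n : ℤ) ∧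
          (Nat.Coprime y.1.1 y.1.2 ∧ y.1.1 ≡ y.1.2 [MOD q₀] ∧ (n₀ * y.1.1).Coprime q₀ ∧ (n₀ * y.1.2).Coprime q₀ ∧
            ((nlo : ℕ) : ℤ) ≤ nVar σ a₁ a₂ q₀ y.2 y.1.1 y.1.2 ∧ nVar σ a₁ a₂ q₀ y.2 y.1.1 y.1.2 < ((nhi : ℕ) : ℤ)))), V y.2 y.1.1 y.1.2 := by
    unfold bGen
    rw [Finset.sum_filter, Finset.sum_product, Finset.sum_product]
  have hcard : ((((B ×ˢ B) ×ˢ (Finset.Icc (-(H : ℤ)) H).filter (fun h : ℤ => h ≠ 0))).filter (fun y : (ℕ × ℕ) × ℤ => (δ₂ * y.1.1 = s ∧ a₂.natAbs * n₀ * δ₁ * y.1.2 = r ∧ nVar σ a₁ a₂ q₀ y.2 y.1.1 y.1.2 = (n : ℤ) ∧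
          (Nat.Coprime y.1.1 y.1.2 ∧ y.1.1 ≡ y.1.2 [MOD q₀] ∧ (n₀ * y.1.1).Coprime q₀ ∧ (n₀ * y.1.2).Coprime q₀ ∧
            ((nlo : ℕ) : ℤ) ≤ nVar σ a₁ a₂ q₀ y.2 y.1.1 y.1.2 ∧ nVar σ a₁ a₂ q₀ y.2 y.1.1 y.1.2 < ((nhi : ℕ) : ℤ))))).card ≤ 1 := by
    refine Finset.card_le_one.2 fun y hy y' hy' => ?_
    rw [Finset.mem_filter] at hy hy'
    obtain ⟨e1, e2, e3⟩ := bCond_unique (σ := σ) (nhi := nhi) ha₂ hn₀ hδ₁ hδ₂ hnlo hy.2 hy'.2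
    exact Prod.ext (Prod.ext e1 e2) e3
  rw [hprod]
  calc _ ≤ ∑ y ∈ (((B ×ˢ B) ×ˢ (Finset.Icc (-(H : ℤ)) H).filter (fun h : ℤ => h ≠ 0))).filter (fun y : (ℕ × ℕ) × ℤ => (δ₂ * y.1.1 = s ∧ a₂.natAbs * n₀ * δ₁ * y.1.2 = r ∧ nVar σ a₁ a₂ q₀ y.2 y.1.1 y.1.2 = (n : ℤ) ∧
          (Nat.Coprime y.1.1 y.1.2 ∧ y.1.1 ≡ y.1.2 [MOD q₀] ∧ (n₀ * y.1.1).Coprime q₀ ∧ (n₀ * y.1.2).Coprime q₀ ∧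
            ((nlo : ℕ) : ℤ) ≤ nVar σ a₁ a₂ q₀ y.2 y.1.1 y.1.2 ∧ nVar σ a₁ a₂ q₀ y.2 y.1.1 y.1.2 < ((nhi : ℕ) : ℤ)))), ‖V y.2 y.1.1 y.1.2‖ :=
        norm_sum_le _ _
    _ ≤ ∑ _y ∈ (((B ×ˢ B) ×ˢ (Finset.Icc (-(H : ℤ)) H).filter (fun h : ℤ => h ≠ 0))).filter (fun y : (ℕ × ℕ) × ℤ => (δ₂ * y.1.1 = s ∧ a₂.natAbs * n₀ * δ₁ * y.1.2 = r ∧ nVar σ a₁ a₂ q₀ y.2 y.1.1 y.1.2 = (n : ℤ) ∧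
          (Nat.Coprime y.1.1 y.1.2 ∧ y.1.1 ≡ y.1.2 [MOD q₀] ∧ (n₀ * y.1.1).Coprime q₀ ∧ (n₀ * y.1.2).Coprime q₀ ∧
            ((nlo : ℕ) : ℤ) ≤ nVar σ a₁ a₂ q₀ y.2 y.1.1 y.1.2 ∧ nVar σ a₁ a₂ q₀ y.2 y.1.1 y.1.2 < ((nhi : ℕ) : ℤ)))), Vmax :=
        Finset.sum_le_sum fun y _ => hV _ _ _
    _ = _ := by rw [Finset.sum_const, nsmul_eq_mul]
    _ ≤ 1 * Vmax := by
        refine mul_le_mul_of_nonneg_right ?_ hV0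
        exact_mod_cast hcard
    _ = Vmax := one_mul _

/-- **Support of `b`**: if `b_{𝐧,𝐫,𝐬} ≠ 0` then `0 < 𝐧 ≤ nhi`, `R < 𝐫 ≤ 2R`, `S' < 𝐬 ≤ 2S'` with
`R = |a₂|δ₁N`, `S' = δ₂N/n₀` (`B` the reduced `n`'s of `ℛ₁''`, `nlo ≥ 1`).
[cite: Drappeau2017, §5.5 p. 20–21] -/
theorem bGen_support {N : ℝ} (hN : 0 ≤ N) (ha₂ : a₂ ≠ 0) (hn₀ : 0 < n₀) (hδ₁ : 0 < δ₁)
    (hδ₂ : 0 < δ₂) (hnlo : 1 ≤ nlo) (H : ℕ) (V : ℤ → ℕ → ℕ → ℂ) {n r s : ℕ}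
    (hb : bGen a₁ a₂ ((((BFI.dyadic N).filter (fun n : ℕ => IsCoprime (n : ℤ) a₂)).filter
      (fun n : ℕ => n₀ ∣ n)).image (fun n : ℕ => n / n₀)) q₀ n₀ H σ nlo nhi δ₁ δ₂ V n r s ≠ 0) :
    0 < n ∧ (n : ℝ) ≤ (nhi : ℝ) ∧ (a₂.natAbs : ℝ) * δ₁ * N < r ∧
      (r : ℝ) ≤ 2 * ((a₂.natAbs : ℝ) * δ₁ * N) ∧ (δ₂ : ℝ) * N / n₀ < s ∧
      (s : ℝ) ≤ 2 * ((δ₂ : ℝ) * N / n₀) := by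
  unfold bGen at hb
  obtain ⟨n₁, hn₁, hb1⟩ := Finset.exists_ne_zero_of_sum_ne_zero hb
  obtain ⟨n₂, hn₂, hb2⟩ := Finset.exists_ne_zero_of_sum_ne_zero hb1
  obtain ⟨h, _, hb3⟩ := Finset.exists_ne_zero_of_sum_ne_zero hb2
  have hc : (δ₂ * n₁ = s ∧ a₂.natAbs * n₀ * δ₁ * n₂ = r ∧ nVar σ a₁ a₂ q₀ h n₁ n₂ = (n : ℤ) ∧
          (Nat.Coprime n₁ n₂ ∧ n₁ ≡ n₂ [MOD q₀] ∧ (n₀ * n₁).Coprime q₀ ∧ (n₀ * n₂).Coprime q₀ ∧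
            ((nlo : ℕ) : ℤ) ≤ nVar σ a₁ a₂ q₀ h n₁ n₂ ∧ nVar σ a₁ a₂ q₀ h n₁ n₂ < ((nhi : ℕ) : ℤ))) := by
    by_contra h'; exact hb3 (if_neg h')
  obtain ⟨hs, hr, hn, -, -, -, -, hlo, hhi⟩ := hc
  obtain ⟨_, _, hd1⟩ := mem_Bset hN hn₀ hn₁
  obtain ⟨_, _, hd2⟩ := mem_Bset hN hn₀ hn₂
  rw [BFI.mem_dyadic hN] at hd1 hd2
  obtain ⟨hd1a, hd1b⟩ := hd1
  obtain ⟨hd2a, hd2b⟩ := hd2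
  push_cast at hd1a hd1b hd2a hd2b
  have hn₀r : (0 : ℝ) < n₀ := by exact_mod_cast hn₀
  have hδ₁r : (0 : ℝ) < δ₁ := by exact_mod_cast hδ₁
  have hδ₂r : (0 : ℝ) < δ₂ := by exact_mod_cast hδ₂
  have har : (0 : ℝ) < a₂.natAbs := by exact_mod_cast Int.natAbs_pos.2 ha₂
  have hnn : ((n : ℕ) : ℤ) = nVar σ a₁ a₂ q₀ h n₁ n₂ := hn.symm
  have hrr : (r : ℝ) = (a₂.natAbs : ℝ) * δ₁ * ((n₀ : ℝ) * n₂) := by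
    rw [← hr]; push_cast; ring
  have hss : (s : ℝ) = (δ₂ : ℝ) * n₁ := by rw [← hs]; push_cast; ring
  refine ⟨?_, ?_, ?_, ?_, ?_, ?_⟩
  · have : (1 : ℤ) ≤ n := by rw [hnn]; exact le_trans (by exact_mod_cast hnlo) hlo
    exact_mod_cast this
  · have : (n : ℤ) ≤ nhi := by rw [hnn]; exact hhi.le
    exact_mod_cast this
  · rw [hrr]
    exact mul_lt_mul_of_pos_left hd2a (by positivity)
  · rw [hrr]; nlinarith [mul_pos har hδ₁r]
  · rw [hss, div_lt_iff₀ hn₀r]; nlinarith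
  · rw [hss]
    have : (δ₂ : ℝ) * n₁ * n₀ ≤ 2 * ((δ₂ : ℝ) * N) := by nlinarith
    rw [show 2 * ((δ₂ : ℝ) * N / n₀) = 2 * ((δ₂ : ℝ) * N) / n₀ by ring, le_div_iff₀ hn₀r]
    exact this

/-- `∑_{𝐧,𝐫,𝐬} 1_{𝐬 = s₀, 𝐫 = r₀, 𝐧 = z, …} ≤ 1`. [folklore] -/
theorem sum3_indicator_le_one (In Ir Is : Finset ℕ) (z : ℤ) (r₀ s₀ : ℕ) (R : Prop) [Decidable R] :
    ∑ n ∈ In, ∑ r ∈ Ir, ∑ s ∈ Is, (if (s₀ = s ∧ r₀ = r ∧ z = (n : ℤ) ∧ R) then (1 : ℝ) else 0) ≤ 1 := by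
  have h01 : ∀ (P : Prop) [Decidable P], (if P then (1 : ℝ) else 0) ≤ 1 := by
    intro P _; split_ifs <;> norm_num
  have h00 : ∀ (P : Prop) [Decidable P], (0 : ℝ) ≤ (if P then (1 : ℝ) else 0) := by
    intro P _; split_ifs <;> norm_num
  have hs : ∀ n r, ∑ s ∈ Is, (if (s₀ = s ∧ r₀ = r ∧ z = (n : ℤ) ∧ R) then (1 : ℝ) else 0) ≤
      if (r₀ = r ∧ z = (n : ℤ)) then 1 else 0 := by
    intro n r
    by_cases hmem : s₀ ∈ Is
    · rw [Finset.sum_eq_single_of_mem s₀ hmem (fun s _ hne => if_neg (fun h' => hne h'.1.symm))]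
      by_cases h2 : (r₀ = r ∧ z = (n : ℤ))
      · rw [if_pos h2]; exact h01 _
      · rw [if_neg h2, if_neg (fun h' => h2 ⟨h'.2.1, h'.2.2.1⟩)]
    · rw [Finset.sum_eq_zero]
      · exact h00 _
      intro s hs'
      rw [if_neg]
      rintro ⟨rfl, -⟩
      exact hmem hs'
  have hr : ∀ n, ∑ r ∈ Ir, (if (r₀ = r ∧ z = (n : ℤ)) then (1 : ℝ) else 0) ≤
      if (z = (n : ℤ)) then 1 else 0 := by
    intro n
    by_cases hmem : r₀ ∈ Ir
    · rw [Finset.sum_eq_single_of_mem r₀ hmem (fun r _ hne => if_neg (fun h' => hne h'.1.symm))]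
      by_cases h2 : (z = (n : ℤ))
      · rw [if_pos h2]; exact h01 _
      · rw [if_neg h2, if_neg (fun h' => h2 h'.2)]
    · rw [Finset.sum_eq_zero]
      · exact h00 _
      intro r hr'
      rw [if_neg]
      rintro ⟨rfl, -⟩
      exact hmem hr'
  have hn : ∑ n ∈ In, (if (z = (n : ℤ)) then (1 : ℝ) else 0) ≤ 1 := by
    by_cases hz : 0 ≤ z ∧ z.toNat ∈ In
    · rw [Finset.sum_eq_single_of_mem z.toNat hz.2 (fun n _ hne => if_neg (fun h' => hne (by omega)))]
      exact h01 _
    · rw [Finset.sum_eq_zero]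
      · norm_num
      intro n hn'
      rw [if_neg]
      intro h'
      apply hz
      have e : z.toNat = n := by omega
      exact ⟨by omega, by rw [e]; exact hn'⟩
  calc _ ≤ ∑ n ∈ In, ∑ r ∈ Ir, (if (r₀ = r ∧ z = (n : ℤ)) then (1 : ℝ) else 0) :=
        Finset.sum_le_sum fun n _ => Finset.sum_le_sum fun r _ => hs n r
    _ ≤ ∑ n ∈ In, (if (z = (n : ℤ)) then (1 : ℝ) else 0) := Finset.sum_le_sum fun n _ => hr n
    _ ≤ 1 := hn

/-- **The `ℓ²` bound**: `∑_{𝐧,𝐫,𝐬} ‖b‖² ≤ (#B)² · #{0<|h|≤H} · sup‖V‖²`.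
[cite: Drappeau2017, §5.5 p. 21] -/
theorem sum_norm_bGen_sq_le (ha₂ : a₂ ≠ 0) (hn₀ : 0 < n₀) (hδ₁ : 0 < δ₁) (hδ₂ : 0 < δ₂)
    (hnlo : 1 ≤ nlo) (B : Finset ℕ) (H : ℕ) (V : ℤ → ℕ → ℕ → ℂ) {Vmax : ℝ} (hV0 : 0 ≤ Vmax)
    (hV : ∀ h n₁ n₂, ‖V h n₁ n₂‖ ≤ Vmax) (In Ir Is : Finset ℕ) :
    ∑ n ∈ In, ∑ r ∈ Ir, ∑ s ∈ Is, ‖bGen a₁ a₂ B q₀ n₀ H σ nlo nhi δ₁ δ₂ V n r s‖ ^ 2 ≤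
      ((B.card : ℝ) ^ 2 * (((Finset.Icc (-(H : ℤ)) H).filter (fun h : ℤ => h ≠ 0)).card : ℝ)) * Vmax ^ 2 := by
  have hpt : ∀ n r s : ℕ, ‖bGen a₁ a₂ B q₀ n₀ H σ nlo nhi δ₁ δ₂ V n r s‖ ^ 2 ≤
      Vmax ^ 2 * ∑ n₁ ∈ B, ∑ n₂ ∈ B, ∑ h ∈ (Finset.Icc (-(H : ℤ)) H).filter (fun h : ℤ => h ≠ 0),
        (if (δ₂ * n₁ = s ∧ a₂.natAbs * n₀ * δ₁ * n₂ = r ∧ nVar σ a₁ a₂ q₀ h n₁ n₂ = (n : ℤ) ∧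
          (Nat.Coprime n₁ n₂ ∧ n₁ ≡ n₂ [MOD q₀] ∧ (n₀ * n₁).Coprime q₀ ∧ (n₀ * n₂).Coprime q₀ ∧
            ((nlo : ℕ) : ℤ) ≤ nVar σ a₁ a₂ q₀ h n₁ n₂ ∧ nVar σ a₁ a₂ q₀ h n₁ n₂ < ((nhi : ℕ) : ℤ))) then (1 : ℝ) else 0) := by
    intro n r s
    have h1 : ‖bGen a₁ a₂ B q₀ n₀ H σ nlo nhi δ₁ δ₂ V n r s‖ ≤
        Vmax * ∑ n₁ ∈ B, ∑ n₂ ∈ B, ∑ h ∈ (Finset.Icc (-(H : ℤ)) H).filter (fun h : ℤ => h ≠ 0),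
          (if (δ₂ * n₁ = s ∧ a₂.natAbs * n₀ * δ₁ * n₂ = r ∧ nVar σ a₁ a₂ q₀ h n₁ n₂ = (n : ℤ) ∧
          (Nat.Coprime n₁ n₂ ∧ n₁ ≡ n₂ [MOD q₀] ∧ (n₀ * n₁).Coprime q₀ ∧ (n₀ * n₂).Coprime q₀ ∧
            ((nlo : ℕ) : ℤ) ≤ nVar σ a₁ a₂ q₀ h n₁ n₂ ∧ nVar σ a₁ a₂ q₀ h n₁ n₂ < ((nhi : ℕ) : ℤ))) then (1 : ℝ) else 0) := by
      unfold bGen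
      rw [Finset.mul_sum]
      refine (norm_sum_le _ _).trans (Finset.sum_le_sum fun n₁ _ => ?_)
      rw [Finset.mul_sum]
      refine (norm_sum_le _ _).trans (Finset.sum_le_sum fun n₂ _ => ?_)
      rw [Finset.mul_sum]
      refine (norm_sum_le _ _).trans (Finset.sum_le_sum fun h _ => ?_)
      split_ifs
      · rw [mul_one]; exact hV _ _ _
      · simp
    have h2 := norm_bGen_le (σ := σ) (nhi := nhi) (q₀ := q₀) (a₁ := a₁) ha₂ hn₀ hδ₁ hδ₂ hnlo B H V
      hV0 hV n r s
    calc ‖bGen a₁ a₂ B q₀ n₀ H σ nlo nhi δ₁ δ₂ V n r s‖ ^ 2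
        = ‖bGen a₁ a₂ B q₀ n₀ H σ nlo nhi δ₁ δ₂ V n r s‖ *
            ‖bGen a₁ a₂ B q₀ n₀ H σ nlo nhi δ₁ δ₂ V n r s‖ := sq _
      _ ≤ Vmax * (Vmax * ∑ n₁ ∈ B, ∑ n₂ ∈ B, ∑ h ∈ (Finset.Icc (-(H : ℤ)) H).filter (fun h : ℤ => h ≠ 0),
            (if (δ₂ * n₁ = s ∧ a₂.natAbs * n₀ * δ₁ * n₂ = r ∧ nVar σ a₁ a₂ q₀ h n₁ n₂ = (n : ℤ) ∧
          (Nat.Coprime n₁ n₂ ∧ n₁ ≡ n₂ [MOD q₀] ∧ (n₀ * n₁).Coprime q₀ ∧ (n₀ * n₂).Coprime q₀ ∧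
            ((nlo : ℕ) : ℤ) ≤ nVar σ a₁ a₂ q₀ h n₁ n₂ ∧ nVar σ a₁ a₂ q₀ h n₁ n₂ < ((nhi : ℕ) : ℤ))) then (1 : ℝ) else 0)) :=
          mul_le_mul h2 h1 (norm_nonneg _) hV0
      _ = _ := by ring
  have hswap : ∑ n ∈ In, ∑ r ∈ Ir, ∑ s ∈ Is, ∑ n₁ ∈ B, ∑ n₂ ∈ B, ∑ h ∈ (Finset.Icc (-(H : ℤ)) H).filter (fun h : ℤ => h ≠ 0),
        (if (δ₂ * n₁ = s ∧ a₂.natAbs * n₀ * δ₁ * n₂ = r ∧ nVar σ a₁ a₂ q₀ h n₁ n₂ = (n : ℤ) ∧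
          (Nat.Coprime n₁ n₂ ∧ n₁ ≡ n₂ [MOD q₀] ∧ (n₀ * n₁).Coprime q₀ ∧ (n₀ * n₂).Coprime q₀ ∧
            ((nlo : ℕ) : ℤ) ≤ nVar σ a₁ a₂ q₀ h n₁ n₂ ∧ nVar σ a₁ a₂ q₀ h n₁ n₂ < ((nhi : ℕ) : ℤ))) then (1 : ℝ) else 0) =
      ∑ n₁ ∈ B, ∑ n₂ ∈ B, ∑ h ∈ (Finset.Icc (-(H : ℤ)) H).filter (fun h : ℤ => h ≠ 0), ∑ n ∈ In, ∑ r ∈ Ir, ∑ s ∈ Is,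
        (if (δ₂ * n₁ = s ∧ a₂.natAbs * n₀ * δ₁ * n₂ = r ∧ nVar σ a₁ a₂ q₀ h n₁ n₂ = (n : ℤ) ∧
          (Nat.Coprime n₁ n₂ ∧ n₁ ≡ n₂ [MOD q₀] ∧ (n₀ * n₁).Coprime q₀ ∧ (n₀ * n₂).Coprime q₀ ∧
            ((nlo : ℕ) : ℤ) ≤ nVar σ a₁ a₂ q₀ h n₁ n₂ ∧ nVar σ a₁ a₂ q₀ h n₁ n₂ < ((nhi : ℕ) : ℤ))) then (1 : ℝ) else 0) := by
    simp only [Finset.sum_comm (s := Is) (t := B), Finset.sum_comm (s := Is) (t := (Finset.Icc (-(H : ℤ)) H).filter (fun h : ℤ => h ≠ 0)),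
      Finset.sum_comm (s := Ir) (t := B), Finset.sum_comm (s := Ir) (t := (Finset.Icc (-(H : ℤ)) H).filter (fun h : ℤ => h ≠ 0)),
      Finset.sum_comm (s := In) (t := B), Finset.sum_comm (s := In) (t := (Finset.Icc (-(H : ℤ)) H).filter (fun h : ℤ => h ≠ 0))]
  calc _ ≤ ∑ n ∈ In, ∑ r ∈ Ir, ∑ s ∈ Is, Vmax ^ 2 * ∑ n₁ ∈ B, ∑ n₂ ∈ B, ∑ h ∈ (Finset.Icc (-(H : ℤ)) H).filter (fun h : ℤ => h ≠ 0),
          (if (δ₂ * n₁ = s ∧ a₂.natAbs * n₀ * δ₁ * n₂ = r ∧ nVar σ a₁ a₂ q₀ h n₁ n₂ = (n : ℤ) ∧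
          (Nat.Coprime n₁ n₂ ∧ n₁ ≡ n₂ [MOD q₀] ∧ (n₀ * n₁).Coprime q₀ ∧ (n₀ * n₂).Coprime q₀ ∧
            ((nlo : ℕ) : ℤ) ≤ nVar σ a₁ a₂ q₀ h n₁ n₂ ∧ nVar σ a₁ a₂ q₀ h n₁ n₂ < ((nhi : ℕ) : ℤ))) then (1 : ℝ) else 0) :=
        Finset.sum_le_sum fun n _ => Finset.sum_le_sum fun r _ => Finset.sum_le_sum fun s _ =>
          hpt n r s
    _ = Vmax ^ 2 * ∑ n ∈ In, ∑ r ∈ Ir, ∑ s ∈ Is, ∑ n₁ ∈ B, ∑ n₂ ∈ B, ∑ h ∈ (Finset.Icc (-(H : ℤ)) H).filter (fun h : ℤ => h ≠ 0),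
          (if (δ₂ * n₁ = s ∧ a₂.natAbs * n₀ * δ₁ * n₂ = r ∧ nVar σ a₁ a₂ q₀ h n₁ n₂ = (n : ℤ) ∧
          (Nat.Coprime n₁ n₂ ∧ n₁ ≡ n₂ [MOD q₀] ∧ (n₀ * n₁).Coprime q₀ ∧ (n₀ * n₂).Coprime q₀ ∧
            ((nlo : ℕ) : ℤ) ≤ nVar σ a₁ a₂ q₀ h n₁ n₂ ∧ nVar σ a₁ a₂ q₀ h n₁ n₂ < ((nhi : ℕ) : ℤ))) then (1 : ℝ) else 0) := by
        rw [Finset.mul_sum]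
        refine Finset.sum_congr rfl fun n _ => ?_
        rw [Finset.mul_sum]
        refine Finset.sum_congr rfl fun r _ => ?_
        rw [Finset.mul_sum]
    _ = Vmax ^ 2 * ∑ n₁ ∈ B, ∑ n₂ ∈ B, ∑ h ∈ (Finset.Icc (-(H : ℤ)) H).filter (fun h : ℤ => h ≠ 0), ∑ n ∈ In, ∑ r ∈ Ir, ∑ s ∈ Is,
          (if (δ₂ * n₁ = s ∧ a₂.natAbs * n₀ * δ₁ * n₂ = r ∧ nVar σ a₁ a₂ q₀ h n₁ n₂ = (n : ℤ) ∧
          (Nat.Coprime n₁ n₂ ∧ n₁ ≡ n₂ [MOD q₀] ∧ (n₀ * n₁).Coprime q₀ ∧ (n₀ * n₂).Coprime q₀ ∧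
            ((nlo : ℕ) : ℤ) ≤ nVar σ a₁ a₂ q₀ h n₁ n₂ ∧ nVar σ a₁ a₂ q₀ h n₁ n₂ < ((nhi : ℕ) : ℤ))) then (1 : ℝ) else 0) := by rw [hswap]
    _ ≤ Vmax ^ 2 * ∑ _n₁ ∈ B, ∑ _n₂ ∈ B, ∑ _h ∈ (Finset.Icc (-(H : ℤ)) H).filter (fun h : ℤ => h ≠ 0), (1 : ℝ) := by
        refine mul_le_mul_of_nonneg_left ?_ (sq_nonneg _)
        refine Finset.sum_le_sum fun n₁ _ => Finset.sum_le_sum fun n₂ _ =>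
          Finset.sum_le_sum fun h _ => ?_
        exact sum3_indicator_le_one In Ir Is _ _ _ _
    _ = _ := by
        simp only [Finset.sum_const, nsmul_eq_mul, mul_one]
        ring

end Coef

end Drappeau2017

end Literature.NumberTheory.Sieve

end
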